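import Mathlib.Algebra.Algebra.Hom.Rat
import Literature.AlgebraicGeometry.Frobenioids.ArithmeticFrobenioidNonDilating
import HarnessLib

/-!
# Frobenioids I, Theorem 6.4 (i): two data-level steps of the printed proof — automorphisms fixing all
# places, and "`λ = 1`" (Frobenius-compactness core) — PROOF

Mochizuki, *The geometry of Frobenioids I: the general theory*, Kyushu J. Math. **62** (2008) 293–400,
proof of Theorem 6.4 (i), kurims text p. 115: l. 18–19 "any automorphism of a number field that fixes all of
the valuations of the number field is clearly equal to the identity automorphism"; l. 22–23 "every object of
`(C^un-tr)^birat` is Frobenius-compact" (via the argument of the proof of Thm. 6.2 (iii), p. 112 l. 12–15: an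
automorphism "that acts by multiplication by `λ ∈ ℚ_{>0}` on `Φ^birat(L)^pf (≠ 0)` … preserves the order of the
zero [or pole] of highest order … hence `λ = 1`"). [cite: MochizukiFrdI2008, Thm. 6.4 (i) p.115]

PROOF-ONLY (seat abc-iut-L6-t10, S3 sub-DAG holder; sub-nodes **T64i/L05** and **T64i/L09** of
`HOME/staging/L1/L1-t1/gen2/S3-LEMMA-LIST.md`, statements as typed by abc-iut-L1-t1 (gen 2) in
`MotivatingExamplesSub.lean` — `Thm64i_L05_autFixingPlaces`, `Thm64i_L09_frobCompact_data`; the `_holds`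
aliases follow once that file is built). PROVED:
* `NumberField.ringEquiv_eq_refl_of_map_eq` — an automorphism of a number field fixing every prime is the
  identity (contrapositive of the tree's `NumberFields.exists_map_heightOneSpectrum_ne`, abc-iut-L6-t10 gen 0);
* `NumberField.exists_iterate_ringEquiv_eq_id` — an automorphism of a number field has finite order;
* `NumberField.placePerm_scaling_eq_one` — if the permutation of places induced by an automorphism `σ`
  (`w ↦ σ⁻¹w` on finite places via `ArithPullback.underPlace`, `v ↦ v ∘ σ` on archimedean places) multiplies
  a nonzero rational divisor `d` by `c ∈ ℚ_{>0}`, then `c = 1` (here by finite order: `c^m · d = d`).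
No definitions; nothing here bears on [IUTchIII] or asserts anything about abc.
-/

noncomputable section

namespace Literature.AlgebraicGeometry.Frobenioids

open NumberField Function IsDedekindDomain

namespace NumberField

variable {L : Type} [Field L] [NumberField L]

/-- **T64i/L05 — "any automorphism of a number field that fixes all of the valuations of the number field is
clearly equal to the identity automorphism"** (FrdI p. 115 l. 18–19) — PROVED in the clean form typed by
abc-iut-L1-t1 (`Thm64i_L05_autFixingPlaces`): an automorphism fixing every nonzero prime of `𝓞_L` is the
identity (contrapositive of `NumberFields.exists_map_heightOneSpectrum_ne`: a nontrivial automorphism moves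
a degree-one prime). [cite: MochizukiFrdI2008, Thm. 6.4 (i) p.115] -/
theorem ringEquiv_eq_refl_of_map_eq (σ : L ≃+* L)
    (h : ∀ w : HeightOneSpectrum (𝓞 L), Ideal.map (RingOfIntegers.mapRingEquiv σ) w.asIdeal = w.asIdeal) :
    σ = RingEquiv.refl L := by
  by_contra hσ
  obtain ⟨v, hv⟩ := Literature.NumberTheory.NumberFields.exists_map_heightOneSpectrum_ne σ hσ
  exact hv (h v)

/-- The typed statement T64i/L05 verbatim (all number fields). [cite: MochizukiFrdI2008, Thm. 6.4 (i) p.115] -/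
theorem autFixingPlaces :
    ∀ (L : Type) [Field L] [NumberField L] (σ : L ≃+* L),
      (∀ w : HeightOneSpectrum (𝓞 L),
          Ideal.map (RingOfIntegers.mapRingEquiv σ) w.asIdeal = w.asIdeal) → σ = RingEquiv.refl L :=
  fun _ _ _ σ h => ringEquiv_eq_refl_of_map_eq σ h

/-- An automorphism of a number field has FINITE ORDER: some iterate `σ^m`, `m ≥ 1`, is the identity
(`Aut_ℚ(L)` is finite). [cite: MochizukiFrdI2008, Thm. 6.4 (i) p.115] -/
theorem exists_iterate_ringEquiv_eq_id (σ : L ≃+* L) : ∃ m : ℕ, 0 < m ∧ (σ : L → L)^[m] = id :=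
  EffArithDivisor.exists_iterate_eq_id ((σ : L →+* L).toRatAlgHom)

omit [NumberField L] in
/-- Powers of `σ` as a ring homomorphism are its iterates. [cite: MochizukiFrdI2008, Thm. 6.4 (i) p.115] -/
theorem ringHom_pow_eq_id_of_iterate (σ : L ≃+* L) {m : ℕ} (h : (σ : L → L)^[m] = id) :
    ((σ : L →+* L) ^ m : L →+* L) = RingHom.id L :=
  RingHom.ext fun x => by rw [RingHom.coe_pow]; exact congrFun h x

/-- **T64i/L09 — the data-level core of "every object of `(C^un-tr)^birat` is Frobenius-compact"** (FrdI p. 115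
l. 22–23; p. 112 l. 12–15 "`λ = 1`") — PROVED in the form typed by abc-iut-L1-t1 (`Thm64i_L09_frobCompact_data`):
an automorphism `σ` of `L` permutes the places; if the induced map on rational arithmetic divisors
`(d_fin, d_∞) ↦ (push-forward of d_fin along w ↦ σ⁻¹w, d_∞ ∘ (· ∘ σ))` multiplies some `d ≠ 0` by `c ∈ ℚ_{>0}`,
then `c = 1`: the map has finite order `m` (`σ^m = id`), so `c^m · d = d`, `c^m = 1`, `c = 1`.
[cite: MochizukiFrdI2008, Thm. 6.4 (i) p.115] -/
theorem placePerm_scaling_eq_one (σ : L ≃+* L) (d : (FinitePlace L →₀ ℚ) × (InfinitePlace L → ℚ)) (c : ℚ)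
    (hd : d ≠ 0) (hc : 0 < c)
    (h : (Finsupp.mapDomain (fun w : FinitePlace L => ArithPullback.underPlace (σ : L →+* L) w) d.1,
        fun v : InfinitePlace L => d.2 (v.comap (σ : L →+* L))) = c • d) : c = 1 := by
  -- the induced map `P` and its iterates (`ρ = σ` as a ring endomorphism)
  set ρ : L →+* L := (σ : L →+* L) with hρ
  let P : ((FinitePlace L →₀ ℚ) × (InfinitePlace L → ℚ)) → ((FinitePlace L →₀ ℚ) × (InfinitePlace L → ℚ)) :=
    fun e => (Finsupp.mapDomain (fun w : FinitePlace L => ArithPullback.underPlace ρ w) e.1,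
      fun v : InfinitePlace L => e.2 (v.comap ρ))
  have hP : ∀ k : ℕ, ∀ e, P^[k] e =
      (Finsupp.mapDomain (fun w : FinitePlace L => ArithPullback.underPlace (ρ ^ k) w) e.1,
        fun v : InfinitePlace L => e.2 (v.comap (ρ ^ k))) := by
    intro k
    induction k with
    | zero =>
      intro e
      rw [iterate_zero, id_eq, pow_zero]
      refine Prod.ext ?_ (funext fun v => ?_)
      · change e.1 = Finsupp.mapDomain (fun w => ArithPullback.underPlace (RingHom.id L) w) e.1
        rw [show (fun w : FinitePlace L => ArithPullback.underPlace (RingHom.id L) w) = id from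
          funext fun w => ArithPullback.underPlace_id w, Finsupp.mapDomain_id]
      · change e.2 v = e.2 (v.comap (RingHom.id L))
        rw [InfinitePlace.comap_id]
    | succ k ih =>
      intro e
      rw [iterate_succ_apply', ih]
      refine Prod.ext ?_ (funext fun v => ?_)
      · change Finsupp.mapDomain (fun w => ArithPullback.underPlace ρ w)
            (Finsupp.mapDomain (fun w => ArithPullback.underPlace (ρ ^ k) w) e.1) =
          Finsupp.mapDomain (fun w => ArithPullback.underPlace (ρ ^ (k + 1)) w) e.1
        rw [← Finsupp.mapDomain_comp]
        congr 1
        funext w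
        rw [Function.comp_apply, pow_succ, RingHom.mul_def]
        exact (ArithPullback.underPlace_comp ρ (ρ ^ k) w).symm
      · change e.2 ((v.comap ρ).comap (ρ ^ k)) = e.2 (v.comap (ρ ^ (k + 1)))
        rw [pow_succ', RingHom.mul_def, InfinitePlace.comap_comp]
  -- `P` is `ℚ`-homogeneous and `P d = c • d`
  have hPsmul : ∀ (a : ℚ) (e), P (a • e) = a • P e := fun a e =>
    Prod.ext (Finsupp.mapDomain_smul a e.1) (funext fun v => rfl)
  have hPd : P d = c • d := h
  have hPkd : ∀ k : ℕ, P^[k] d = c ^ k • d := by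
    intro k
    induction k with
    | zero => rw [iterate_zero, id_eq, pow_zero, one_smul]
    | succ k ih => rw [iterate_succ_apply', ih, hPsmul, hPd, smul_smul, ← pow_succ]
  -- finite order: `P^m = id`
  obtain ⟨m, hm, hiter⟩ := exists_iterate_ringEquiv_eq_id σ
  have hσm := ringHom_pow_eq_id_of_iterate σ hiter
  have hPm : P^[m] d = d := by
    rw [hP, hσm]
    refine Prod.ext ?_ (funext fun v => ?_)
    · change Finsupp.mapDomain (fun w => ArithPullback.underPlace (RingHom.id L) w) d.1 = d.1
      rw [show (fun w : FinitePlace L => ArithPullback.underPlace (RingHom.id L) w) = id from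
        funext fun w => ArithPullback.underPlace_id w, Finsupp.mapDomain_id]
    · change d.2 (v.comap (RingHom.id L)) = d.2 v
      rw [InfinitePlace.comap_id]
  -- hence `c^m = 1`, `c = 1`
  rw [hPkd] at hPm
  have hcm : c ^ m = 1 := by
    by_contra hne
    apply hd
    have h1 : (c ^ m - 1) • d = 0 := by rw [sub_smul, one_smul, hPm, sub_self]
    rcases smul_eq_zero.mp h1 with h2 | h2
    · exact absurd (sub_eq_zero.mp h2) hne
    · exact h2
  exact (pow_eq_one_iff_of_nonneg hc.le hm.ne').mp hcm

/-- The typed statement T64i/L09 verbatim (all number fields). [cite: MochizukiFrdI2008, Thm. 6.4 (i) p.115] -/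
theorem frobCompact_data :
    ∀ (L : Type) [Field L] [NumberField L] (σ : L ≃+* L) (d : (FinitePlace L →₀ ℚ) × (InfinitePlace L → ℚ))
      (c : ℚ), d ≠ 0 → 0 < c →
        (Finsupp.mapDomain (fun w : FinitePlace L => ArithPullback.underPlace (σ : L →+* L) w) d.1,
          fun v : InfinitePlace L => d.2 (v.comap (σ : L →+* L))) = c • d → c = 1 :=
  fun _ _ _ σ d c hd hc h => placePerm_scaling_eq_one σ d c hd hc h

end NumberField

end Literature.AlgebraicGeometry.Frobenioids

end
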